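import Summits.ABC.IUTFork.Repair.RHLabelGlobal
import Summits.ABC.IUTFork.Cor312PilotIdelesPrCapstone
import Summits.ABC.IUTFork.Cor312LicenceDeepReal
import Summits.ABC.IUTFork.Cor312ProvK
import HarnessLib

/-!
# R-H ROUND 1 row 22 «label-global» — H⋆_22 AT THE TREE CURRENCY `settingPrVolSharp (Cor312Prov.pilotDataOfK D K) …`

PROOF-ONLY companion (no definitions) of `Summits/ABC/IUTFork/Repair/RHLabelGlobal.lean` (p460565, author abc-iut-lens-dual-3,
decl of record `RH.LabelGlobal.HStarLabelGlobal (P : Cor312.Setting S)`), written by the row-22 typer (abc-iut-rh-typ-6, D-0079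
RESCUE.H round 1).  Row 22 verbatim (RH-CANDIDATES v1.7): «LABEL-GLOBAL: for each label j in F_l^* SEPARATELY, the place-SUMMED
q-volume Σ_v qLocal(j,v) ≤ Σ_v logvol(hull U_{j,v}) (per-label, place-summed; summing over j gives the averaged Statement)».

The bed-agnostic hypothesis is instantiated here at abc-iut-c312-7's print-normalised real setting with the Dupuy–Hilado pilot
regions read off ideles, `Thm311.Real.settingPrVolSharp X …` — §1 for ANY pilot datum `X : PilotData F`, §2 at the genuine
`K`-level datum `X := Cor312Prov.pilotDataOfK D K` of a collection of initial Θ-data `D` ([IUTchI] Def. 3.1):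

* `statement_settingPrVolSharp_of_hStar` / `…_pilotDataOfK_of_hStar` — **k2 door (b) with `ThetaFinite` DISCHARGED**:
  H⋆_22 ⟹ the printed Statement of [IUTchIII] Cor. 3.12 at that setting, the finiteness input of
  `statement_of_hStarLabelGlobal` being abc-iut-c312-7's theorem `thetaFinite_settingPrVolSharp` (only the idele side
  conditions remain: Θ- and q-ideles non-zero and units off `S`);
* `hStar_settingPrVolSharp_of_qLocal_le` — READING 0 (packetwise volumes) ⟹ H⋆_22 there;
* `hStar_settingPrVolSharp_of_licence` / `…_pilotDataOfK_of_licence` — the (xi-f) licence ⟹ H⋆_22 there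
  (`Cor312Vol.qLocal_le_thetaLocal_of_licence` over `bridgeHyps_settingPrVolSharp_of_ideles`): every R-H row whose k2 door
  is the licence at this bed (rows 5, 6, 15, 16, 18, 20, 21 of RH-CANDIDATES v1.7) implies row 22 BY NAME.

HONEST FRAMING: H⋆_22 is a claim-tagged HYPOTHESIS, never asserted; nothing here asserts that abc is proved or refuted; no side
is taken on [IUTchIII] Cor. 3.12 or on any author; typed ≠ proved ≠ endorsed.
-/

noncomputable section

open Set Function NumberField IsDedekindDomain
open scoped Pointwise

namespace Summit.ABC.IUTFork.Repair.RH.LabelGlobal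

open Literature.IUT.LogThetaLattice Literature.IUT.LogVolume Literature.IUT.HodgeTheaters
open Summit.ABC.IUTFork.Thm311 Summit.ABC.IUTFork.Thm311.Real Summit.ABC.IUTFork.Cor312 Summit.ABC.IUTFork.Cor312.Setting
  Summit.ABC.IUTFork.Cor312Vol Summit.ABC.IUTFork.Cor312Prov

/-! ## §1. Any Dupuy–Hilado pilot datum `X`, setting `settingPrVolSharp X …` -/

section AnyDatum

variable {F : Type} [Field F] [NumberField F] (X : PilotData F) {logv : PadicLogs F} (hlog : LogvAnalytic logv)
  (M : Type) [Field M] [NumberField M]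
  (archPk : ∀ (j : (thetaIndex X).Label) (vQ : (thetaIndex X).VQ), Set ((logShellsDH X logv).Packet j vQ))
  (archSub : ∀ (j : (thetaIndex X).Label) (v : (thetaIndex X).V),
    Set ((logShellsDH X logv).Packet j ((thetaIndex X).over v)))
  (Ψ : ℤ → ∀ v : (thetaIndex X).V, v ∈ (thetaIndex X).Vbad → Set ((logShellsDH X logv).StarPacket v))
  (act : ℤ → ∀ v : (thetaIndex X).V, v ∈ (thetaIndex X).Vbad →
    (logShellsDH X logv).StarPacket v → Module.End ℚ ((logShellsDH X logv).StarPacket v))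
  (Mmod : ℤ → ∀ j : (thetaIndex X).LabelStar, Set ((logShellsDH X logv).GlobalPacket j.1))
  (region : ℤ → ∀ j : (thetaIndex X).LabelStar, FinDivisor M → ∀ vQ : (thetaIndex X).VQ,
    Set ((logShellsDH X logv).Packet j.1 vQ))
  (n : ℤ) {HT : Type} {LogLink : HT → HT → Type} {IsFull : ∀ {s t : HT}, LogLink s t → Prop}
  (lat : LGPGaussianLogThetaLattice LogLink IsFull)
  {Frd : Type} {IsoF : Frd → Frd → Type} {Ob : Frd → Type} {realify : Frd → Frd} {Strip : Type}
  {IsoS : Strip → Strip → Type} {Mv : ∀ v : (thetaIndex X).V, v ∈ (thetaIndex X).Vbad → Type}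
  [∀ v h, Monoid (Mv v h)]
  (sig : GlobalLGPFrobenioidSignature (thetaIndex X).lstar (thetaIndex X).V (· ∈ (thetaIndex X).Vbad)
    Frd IsoF Ob realify Strip IsoS Mv)
  (split : SplittingMonoids Mv) {ObΔ : Type} {N : ∀ v : (thetaIndex X).V, v ∈ (thetaIndex X).Vbad → Type}
  [∀ v h, Monoid (N v h)] (qData : QPilotData ObΔ N)
  (t : ∀ (pp : Nat.Primes) (_ : Fin X.lstar) (x : (thetaIndex X).Fibre (.inr pp)),
    haveI : Fact (pp : ℕ).Prime := ⟨pp.2⟩; kOf X pp.1 x)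
  (tq : ∀ (pp : Nat.Primes) (x : (thetaIndex X).Fibre (.inr pp)), haveI : Fact (pp : ℕ).Prime := ⟨pp.2⟩; kOf X pp.1 x)

/-- **k2 door (b) at `settingPrVolSharp X …`, `ThetaFinite` DISCHARGED.** For Θ-ideles `t` and `q`-ideles `tq` that are non-zero
and units off `S`: H⋆_22 (`HStarLabelGlobal`) at the print-normalised real Dupuy–Hilado setting implies the printed Statement of
[IUTchIII] Cor. 3.12 there ("`−|log(Θ)| ∈ ℝ` and `−|log(Θ)| ≥ −|log(q)|`") — `statement_of_hStarLabelGlobal` fed with abc-iut-c312-7's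
`thetaFinite_settingPrVolSharp`. [cite: Mochizuki2012, IUTchIII Cor. 3.12 p. 174 l. 16–18] [cite: DupuyHilado2025, §3.4, §3.9]
[claim: Mochizuki2012, status: disputed] (conditional on the hypothesis H⋆_22, never asserted) -/
theorem statement_settingPrVolSharp_of_hStar (ht0 : ∀ pp i x, t pp i x ≠ 0)
    (ht1 : ∀ (pp : Nat.Primes) (i : Fin X.lstar) (x : (thetaIndex X).Fibre (.inr pp)),
      haveI : Fact (pp : ℕ).Prime := ⟨pp.2⟩; placeOf X pp.1 x ∉ X.S → ‖t pp i x‖ = 1)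
    (htq0 : ∀ pp x, tq pp x ≠ 0)
    (htq1 : ∀ (pp : Nat.Primes) (x : (thetaIndex X).Fibre (.inr pp)),
      haveI : Fact (pp : ℕ).Prime := ⟨pp.2⟩; placeOf X pp.1 x ∉ X.S → ‖tq pp x‖ = 1)
    (h : HStarLabelGlobal
      (settingPrVolSharp X hlog M archPk archSub Ψ act Mmod region n lat sig split qData tq t htq0 htq1)) :
    (settingPrVolSharp X hlog M archPk archSub Ψ act Mmod region n lat sig split qData tq t htq0 htq1).Statement :=
  statement_of_hStarLabelGlobal
    (thetaFinite_settingPrVolSharp X hlog M archPk archSub Ψ act Mmod region n lat sig split qData t tq ht0 ht1 htq0 htq1) h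

/-- **READING 0 ⟹ H⋆_22 at `settingPrVolSharp X …`**: the packetwise volume inequality at every label of `𝔽_l^⋇` and every `v_ℚ`
sums (finite supports: `qSupport_finite`, `thetaFinite_settingPrVolSharp`) to the per-label place-summed one. [folklore] -/
theorem hStar_settingPrVolSharp_of_qLocal_le (ht0 : ∀ pp i x, t pp i x ≠ 0)
    (ht1 : ∀ (pp : Nat.Primes) (i : Fin X.lstar) (x : (thetaIndex X).Fibre (.inr pp)),
      haveI : Fact (pp : ℕ).Prime := ⟨pp.2⟩; placeOf X pp.1 x ∉ X.S → ‖t pp i x‖ = 1)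
    (htq0 : ∀ pp x, tq pp x ≠ 0)
    (htq1 : ∀ (pp : Nat.Primes) (x : (thetaIndex X).Fibre (.inr pp)),
      haveI : Fact (pp : ℕ).Prime := ⟨pp.2⟩; placeOf X pp.1 x ∉ X.S → ‖tq pp x‖ = 1)
    (h : ∀ (i : Fin (thetaIndex X).lstar) (vQ : (thetaIndex X).VQ),
      (settingPrVolSharp X hlog M archPk archSub Ψ act Mmod region n lat sig split qData tq t htq0 htq1).qLocal
          (Setting.labelSucc i) vQ ≤
        ((settingPrVolSharp X hlog M archPk archSub Ψ act Mmod region n lat sig split qData tq t htq0 htq1).thetaLocal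
          (Setting.labelSucc i) vQ).untopD 0) :
    HStarLabelGlobal (settingPrVolSharp X hlog M archPk archSub Ψ act Mmod region n lat sig split qData tq t htq0 htq1) :=
  hStarLabelGlobal_of_qLocal_le
    (thetaFinite_settingPrVolSharp X hlog M archPk archSub Ψ act Mmod region n lat sig split qData t tq ht0 ht1 htq0 htq1) h

/-- **The (xi-f) licence ⟹ H⋆_22 at `settingPrVolSharp X …`**: abc-iut-c312-1's `Thm311ToCor312.Licence` gives READING 0 there
(`Cor312Vol.qLocal_le_thetaLocal_of_licence` over abc-iut-c312-7's `bridgeHyps_settingPrVolSharp_of_ideles`, every bridge field a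
theorem), hence H⋆_22.  So every R-H candidate whose k2 door is the licence at this bed implies row 22 by name.
[cite: Mochizuki2012, IUTchIII Step (xi) (xi-f) p. 184] [claim: Mochizuki2012, status: disputed] (conditional on the licence, never asserted) -/
theorem hStar_settingPrVolSharp_of_licence (ht0 : ∀ pp i x, t pp i x ≠ 0)
    (ht1 : ∀ (pp : Nat.Primes) (i : Fin X.lstar) (x : (thetaIndex X).Fibre (.inr pp)),
      haveI : Fact (pp : ℕ).Prime := ⟨pp.2⟩; placeOf X pp.1 x ∉ X.S → ‖t pp i x‖ = 1)
    (htq0 : ∀ pp x, tq pp x ≠ 0)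
    (htq1 : ∀ (pp : Nat.Primes) (x : (thetaIndex X).Fibre (.inr pp)),
      haveI : Fact (pp : ℕ).Prime := ⟨pp.2⟩; placeOf X pp.1 x ∉ X.S → ‖tq pp x‖ = 1)
    (hlic : Thm311ToCor312.Licence
      (settingPrVolSharp X hlog M archPk archSub Ψ act Mmod region n lat sig split qData tq t htq0 htq1)) :
    HStarLabelGlobal (settingPrVolSharp X hlog M archPk archSub Ψ act Mmod region n lat sig split qData tq t htq0 htq1) :=
  hStar_settingPrVolSharp_of_qLocal_le X hlog M archPk archSub Ψ act Mmod region n lat sig split qData t tq ht0 ht1 htq0 htq1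
    (qLocal_le_thetaLocal_of_licence
      (bridgeHyps_settingPrVolSharp_of_ideles X hlog M archPk archSub Ψ act Mmod region n lat sig split qData t tq ht0 ht1
        htq0 htq1) hlic)

/-- **Contrapositive at `settingPrVolSharp X …`**: where H⋆_22 FAILS, the (xi-f) licence fails — a refutation of row 22 at a genuine
bed would refute every licence-door candidate there as well. [claim: Mochizuki2012, status: disputed] (conditional, never asserted) -/
theorem not_licence_settingPrVolSharp_of_not_hStar (ht0 : ∀ pp i x, t pp i x ≠ 0)
    (ht1 : ∀ (pp : Nat.Primes) (i : Fin X.lstar) (x : (thetaIndex X).Fibre (.inr pp)),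
      haveI : Fact (pp : ℕ).Prime := ⟨pp.2⟩; placeOf X pp.1 x ∉ X.S → ‖t pp i x‖ = 1)
    (htq0 : ∀ pp x, tq pp x ≠ 0)
    (htq1 : ∀ (pp : Nat.Primes) (x : (thetaIndex X).Fibre (.inr pp)),
      haveI : Fact (pp : ℕ).Prime := ⟨pp.2⟩; placeOf X pp.1 x ∉ X.S → ‖tq pp x‖ = 1)
    (h : ¬ HStarLabelGlobal (settingPrVolSharp X hlog M archPk archSub Ψ act Mmod region n lat sig split qData tq t htq0 htq1)) :
    ¬ Thm311ToCor312.Licence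
      (settingPrVolSharp X hlog M archPk archSub Ψ act Mmod region n lat sig split qData tq t htq0 htq1) :=
  fun hlic => h (hStar_settingPrVolSharp_of_licence X hlog M archPk archSub Ψ act Mmod region n lat sig split qData t tq ht0
    ht1 htq0 htq1 hlic)

end AnyDatum

/-! ## §2. The genuine `K`-level datum `X := Cor312Prov.pilotDataOfK D K` of a collection of initial Θ-data `D` -/

section Genuine

variable {F K Fbar : Type} [Field F] [NumberField F] [Field K] [NumberField K] [Algebra F K] [Field Fbar]
  [Algebra F Fbar] [Algebra K Fbar] {E : WeierstrassCurve F} [E.IsElliptic] {l : ℕ} {Pb : BadPlacePredicates K}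
  (D : InitialThetaData F K Fbar E l Pb)
  {logv : PadicLogs K} (hlog : LogvAnalytic logv)
  (M : Type) [Field M] [NumberField M]
  (archPk : ∀ (j : (thetaIndex (pilotDataOfK D K)).Label) (vQ : (thetaIndex (pilotDataOfK D K)).VQ),
    Set ((logShellsDH (pilotDataOfK D K) logv).Packet j vQ))
  (archSub : ∀ (j : (thetaIndex (pilotDataOfK D K)).Label) (v : (thetaIndex (pilotDataOfK D K)).V),
    Set ((logShellsDH (pilotDataOfK D K) logv).Packet j ((thetaIndex (pilotDataOfK D K)).over v)))
  (Ψ : ℤ → ∀ v : (thetaIndex (pilotDataOfK D K)).V, v ∈ (thetaIndex (pilotDataOfK D K)).Vbad →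
    Set ((logShellsDH (pilotDataOfK D K) logv).StarPacket v))
  (act : ℤ → ∀ v : (thetaIndex (pilotDataOfK D K)).V, v ∈ (thetaIndex (pilotDataOfK D K)).Vbad →
    (logShellsDH (pilotDataOfK D K) logv).StarPacket v → Module.End ℚ ((logShellsDH (pilotDataOfK D K) logv).StarPacket v))
  (Mmod : ℤ → ∀ j : (thetaIndex (pilotDataOfK D K)).LabelStar, Set ((logShellsDH (pilotDataOfK D K) logv).GlobalPacket j.1))
  (region : ℤ → ∀ j : (thetaIndex (pilotDataOfK D K)).LabelStar, FinDivisor M → ∀ vQ : (thetaIndex (pilotDataOfK D K)).VQ,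
    Set ((logShellsDH (pilotDataOfK D K) logv).Packet j.1 vQ))
  (n : ℤ) {HT : Type} {LogLink : HT → HT → Type} {IsFull : ∀ {s t : HT}, LogLink s t → Prop}
  (lat : LGPGaussianLogThetaLattice LogLink IsFull)
  {Frd : Type} {IsoF : Frd → Frd → Type} {Ob : Frd → Type} {realify : Frd → Frd} {Strip : Type}
  {IsoS : Strip → Strip → Type} {Mv : ∀ v : (thetaIndex (pilotDataOfK D K)).V, v ∈ (thetaIndex (pilotDataOfK D K)).Vbad → Type}
  [∀ v h, Monoid (Mv v h)]
  (sig : GlobalLGPFrobenioidSignature (thetaIndex (pilotDataOfK D K)).lstar (thetaIndex (pilotDataOfK D K)).V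
    (· ∈ (thetaIndex (pilotDataOfK D K)).Vbad) Frd IsoF Ob realify Strip IsoS Mv)
  (split : SplittingMonoids Mv) {ObΔ : Type} {N : ∀ v : (thetaIndex (pilotDataOfK D K)).V, v ∈ (thetaIndex (pilotDataOfK D K)).Vbad → Type}
  [∀ v h, Monoid (N v h)] (qData : QPilotData ObΔ N)
  (t : ∀ (pp : Nat.Primes) (_ : Fin (pilotDataOfK D K).lstar) (x : (thetaIndex (pilotDataOfK D K)).Fibre (.inr pp)),
    haveI : Fact (pp : ℕ).Prime := ⟨pp.2⟩; kOf (pilotDataOfK D K) pp.1 x)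
  (tq : ∀ (pp : Nat.Primes) (x : (thetaIndex (pilotDataOfK D K)).Fibre (.inr pp)),
    haveI : Fact (pp : ℕ).Prime := ⟨pp.2⟩; kOf (pilotDataOfK D K) pp.1 x)

/-- **H⋆_22 AT THE GENUINE SHARP BED ⟹ the printed Statement of [IUTchIII] Cor. 3.12 there** (k2 door (b) of row 22 in the tree's
currency `settingPrVolSharp (pilotDataOfK D K) …`, `ThetaFinite` discharged; Θ-ideles and `q`-ideles non-zero and units off `S` — e.g. realising
`P_Θ`, `P_q`). [cite: Mochizuki2012, IUTchI Def. 3.1 p. 61, IUTchIII Cor. 3.12 p. 174] [cite: DupuyHilado2025, §3.3, §3.4, §3.9]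
[claim: Mochizuki2012, status: disputed] (conditional on the hypothesis H⋆_22, never asserted) -/
theorem statement_settingPrVolSharp_pilotDataOfK_of_hStar (ht0 : ∀ pp i x, t pp i x ≠ 0)
    (ht1 : ∀ (pp : Nat.Primes) (i : Fin (pilotDataOfK D K).lstar) (x : (thetaIndex (pilotDataOfK D K)).Fibre (.inr pp)),
      haveI : Fact (pp : ℕ).Prime := ⟨pp.2⟩; placeOf (pilotDataOfK D K) pp.1 x ∉ (pilotDataOfK D K).S → ‖t pp i x‖ = 1)
    (htq0 : ∀ pp x, tq pp x ≠ 0)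
    (htq1 : ∀ (pp : Nat.Primes) (x : (thetaIndex (pilotDataOfK D K)).Fibre (.inr pp)),
      haveI : Fact (pp : ℕ).Prime := ⟨pp.2⟩; placeOf (pilotDataOfK D K) pp.1 x ∉ (pilotDataOfK D K).S → ‖tq pp x‖ = 1)
    (h : HStarLabelGlobal
      (settingPrVolSharp (pilotDataOfK D K) hlog M archPk archSub Ψ act Mmod region n lat sig split qData tq t htq0 htq1)) :
    (settingPrVolSharp (pilotDataOfK D K) hlog M archPk archSub Ψ act Mmod region n lat sig split qData tq t htq0 htq1).Statement :=
  statement_settingPrVolSharp_of_hStar (pilotDataOfK D K) hlog M archPk archSub Ψ act Mmod region n lat sig split qData t tq ht0 ht1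
    htq0 htq1 h

/-- **The (xi-f) licence at the genuine sharp bed ⟹ H⋆_22 there**: rows of RH-CANDIDATES v1.7 whose k2 door is
`Thm311ToCor312.Licence (settingPrVolSharp (pilotDataOfK D K) …)` (e.g. row 6 `RHShallowWuc.licence_settingPrVolSharp_pilotDataOfK_of_hStar`,
row 5's tame band licence) imply row 22 BY NAME. [cite: Mochizuki2012, IUTchIII Step (xi) (xi-f) p. 184]
[claim: Mochizuki2012, status: disputed] (conditional on the licence, never asserted) -/
theorem hStar_settingPrVolSharp_pilotDataOfK_of_licence (ht0 : ∀ pp i x, t pp i x ≠ 0)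
    (ht1 : ∀ (pp : Nat.Primes) (i : Fin (pilotDataOfK D K).lstar) (x : (thetaIndex (pilotDataOfK D K)).Fibre (.inr pp)),
      haveI : Fact (pp : ℕ).Prime := ⟨pp.2⟩; placeOf (pilotDataOfK D K) pp.1 x ∉ (pilotDataOfK D K).S → ‖t pp i x‖ = 1)
    (htq0 : ∀ pp x, tq pp x ≠ 0)
    (htq1 : ∀ (pp : Nat.Primes) (x : (thetaIndex (pilotDataOfK D K)).Fibre (.inr pp)),
      haveI : Fact (pp : ℕ).Prime := ⟨pp.2⟩; placeOf (pilotDataOfK D K) pp.1 x ∉ (pilotDataOfK D K).S → ‖tq pp x‖ = 1)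
    (hlic : Thm311ToCor312.Licence
      (settingPrVolSharp (pilotDataOfK D K) hlog M archPk archSub Ψ act Mmod region n lat sig split qData tq t htq0 htq1)) :
    HStarLabelGlobal
      (settingPrVolSharp (pilotDataOfK D K) hlog M archPk archSub Ψ act Mmod region n lat sig split qData tq t htq0 htq1) :=
  hStar_settingPrVolSharp_of_licence (pilotDataOfK D K) hlog M archPk archSub Ψ act Mmod region n lat sig split qData t tq ht0 ht1
    htq0 htq1 hlic

/-- **Contrapositive at the genuine sharp bed**: ¬H⋆_22 there ⟹ ¬(xi-f) licence there. [claim: Mochizuki2012, status: disputed]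
(conditional, never asserted) -/
theorem not_licence_settingPrVolSharp_pilotDataOfK_of_not_hStar (ht0 : ∀ pp i x, t pp i x ≠ 0)
    (ht1 : ∀ (pp : Nat.Primes) (i : Fin (pilotDataOfK D K).lstar) (x : (thetaIndex (pilotDataOfK D K)).Fibre (.inr pp)),
      haveI : Fact (pp : ℕ).Prime := ⟨pp.2⟩; placeOf (pilotDataOfK D K) pp.1 x ∉ (pilotDataOfK D K).S → ‖t pp i x‖ = 1)
    (htq0 : ∀ pp x, tq pp x ≠ 0)
    (htq1 : ∀ (pp : Nat.Primes) (x : (thetaIndex (pilotDataOfK D K)).Fibre (.inr pp)),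
      haveI : Fact (pp : ℕ).Prime := ⟨pp.2⟩; placeOf (pilotDataOfK D K) pp.1 x ∉ (pilotDataOfK D K).S → ‖tq pp x‖ = 1)
    (h : ¬ HStarLabelGlobal
      (settingPrVolSharp (pilotDataOfK D K) hlog M archPk archSub Ψ act Mmod region n lat sig split qData tq t htq0 htq1)) :
    ¬ Thm311ToCor312.Licence
      (settingPrVolSharp (pilotDataOfK D K) hlog M archPk archSub Ψ act Mmod region n lat sig split qData tq t htq0 htq1) :=
  not_licence_settingPrVolSharp_of_not_hStar (pilotDataOfK D K) hlog M archPk archSub Ψ act Mmod region n lat sig split qData t tq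
    ht0 ht1 htq0 htq1 h

end Genuine

end Summit.ABC.IUTFork.Repair.RH.LabelGlobal

end
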